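import Literature.NumberTheory.LFunctions.ZetaLogDerivRH
import Literature.NumberTheory.LFunctions.RHInvZetaBound
import Literature.NumberTheory.LFunctions.InvZetaGoodHeights
import Literature.Analysis.SpecialFunctions.GammaStirlingOrder
import Literature.Analysis.Complex.HeightAveraging
import Mathlib.NumberTheory.Harmonic.ZetaAsymp
import HarnessLib

/-!
# `1/ζ(σ ± iT) ≪ T^ε` across the critical strip at very good heights, under RH

Topic `Literature/NumberTheory/LFunctions`. Everything in this file is PROVED.

Explicit formulae of "`1/ζ` type" with a second-order kernel — `∑_{n ≤ N} μ(n) n^{-s} log(N/n) =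
(1/2πi) ∫ N^w ζ(s+w)⁻¹ dw/w²` (Bettin–Conrey–Farmer 2013, Lemma 2) — move the line of
integration across the critical strip along horizontal segments `Im = ±T`, against a kernel that
decays only like `T⁻²`; they need `1/ζ(σ ± iT) = O(T^ε)` *uniformly in `σ`* at suitable heights
`T → ∞`. Under RH this is Titchmarsh's Theorem 14.16 / Montgomery–Vaughan's Theorem 13.22 ("each
interval `[T, T+1]` contains a `t` with `1/ζ(σ+it) ≪ t^ε`, `−1 ≤ σ ≤ 2`"). The tree's
`InvZetaGoodHeights.lean` only gives `exp(O(log² T))` (enough against Gaussian kernels). This file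
proves the `T^ε` form on `1/4 ≤ σ ≤ 2`, from results already in the tree:

* on `σ ≥ 1/2 + η`: Littlewood's `1/ζ(σ+it) = O(t^ε)` (Titchmarsh (14.2.6),
  `Literature.NumberTheory.LFunctions.InvZetaRH.norm_inv_riemannZeta_le_rpow`);
* on `1/4 ≤ σ ≤ 1/2 − η`: the functional equation `ζ(1−s) = 2(2π)^{-s}Γ(s)cos(πs/2)ζ(s)` (Mathlib
  `riemannZeta_one_sub`) with the lower bound `‖Γ(s) cos(πs/2)‖ ≥ (2/15)·(1/4)` on
  `1/2 ≤ Re s ≤ 1`, `|Im s| ≥ 1` (`Literature.Analysis.SpecialFunctions.norm_Gamma_ge_exp`,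
  `Literature.Analysis.SpecialFunctions.abs_sinh_im_le_norm_cos`), reducing to Littlewood at `1 − σ`;
* on `|σ − 1/2| ≤ η` (the new step, Titchmarsh §9.7's integration argument): integrate the partial
  fraction `ζ'/ζ(s) = ∑_{|ρ−(2+iT)| ≤ 37/20} m(ρ)/(s−ρ) + O(log T)` (Montgomery–Vaughan Lemma 12.1,
  `Literature.NumberTheory.LFunctions.exists_norm_logDeriv_zeta_sub_sum_le`) along `[σ, 1/2+η] + iT`
  (Grönwall, `Literature.NumberTheory.LFunctions.norm_inv_le_norm_inv_mul_exp`, applied to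
  `ζ(s)/∏(s−ρ)^{m(ρ)}`):
  `|1/ζ(σ+iT)| ≤ |1/ζ(1/2+η+iT)| · (T+2)^{2ηC} · ∏_ρ (1 + 2η/|T−γ|)^{m(ρ)}`,
  and `∏ ≤ exp(4√(2η) ∑ m(ρ)|T−γ|^{-1/2}) ≤ exp(32√(2η) ∑ m(ρ)) = T^{O(√η)}` for the heights `T`
  selected by averaging over `[T', T'+1]` (`Literature.Analysis.Complex.HeightAvg.exists_height_sum_rpow_le`,
  with `N(T+1) − N(T) ≪ log T`, `Literature.NumberTheory.LFunctions.exists_sum_zetaZeroWindow_le`).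

Main result:

* `Literature.NumberTheory.LFunctions.VeryGoodHeights.exists_norm_inv_zeta_le_rpow` — under RH, for
  every `ε > 0` there is `T₀` such that every interval `[T', T'+1]`, `T' ≥ T₀`, contains a `T`,
  not the ordinate `±γ` of any zero `β + iγ` with `β ≥ 1/4`, with
  `‖1/ζ(σ + iT)‖ ≤ T^ε` and `‖1/ζ(σ − iT)‖ ≤ T^ε` for all `σ ∈ [1/4, 2]`.

## References

* E. C. Titchmarsh, *The Theory of the Riemann Zeta-Function*, 2nd ed. (1986), §9.7 (proof of
  Thm. 9.7: choice of `t` by integrating `∑ log|t − γ|`), Thm. 14.16.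
* H. L. Montgomery, R. C. Vaughan, *Multiplicative Number Theory I*, CUP 2007, Lemma 12.1,
  Thm. 13.22.
* S. Bettin, J. B. Conrey, D. W. Farmer, Proc. Steklov Inst. Math. 280 (2013), suppl. 2, Lemma 2
  (the user: `BettinConreyFarmer2013.lean`).
-/

noncomputable section

open Complex Filter Set Metric MeromorphicOn Real
open scoped Topology ComplexConjugate

namespace Literature.NumberTheory.LFunctions

namespace VeryGoodHeights

/-! ## The zeros near height `T'`, covered by six unit windows -/

/-- The zeros `ρ` of `ζ` with `Re ρ ≥ 1/4` in the six unit windows centred at `T' − 3/2 + j`,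
`j = 0, …, 5` (so with ordinates in `[T'−2, T'+4]`), each listed once. [folklore] -/
def nearZeros (T' : ℝ) : Finset ℂ :=
  (Finset.range 6).biUnion fun j ↦ (zetaZeroWindow_finite (T' - 3 / 2 + j)).toFinset

/-- Members of `nearZeros T'` are zeros with `Re ρ ≥ 1/4` and ordinate in `[T'−2, T'+4]`. [folklore] -/
theorem mem_nearZeros {T' : ℝ} {ρ : ℂ} (h : ρ ∈ nearZeros T') :
    riemannZeta ρ = 0 ∧ 1 / 4 ≤ ρ.re ∧ ρ.im ∈ Icc (T' - 2) (T' + 4) := by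
  simp only [nearZeros, Finset.mem_biUnion, Finset.mem_range, Set.Finite.mem_toFinset] at h
  obtain ⟨j, hj, h0, h1, h2⟩ := h
  rw [abs_le] at h2
  have hj' : (j : ℝ) ≤ 5 := by exact_mod_cast Nat.lt_succ_iff.1 hj
  have hj0 : (0 : ℝ) ≤ j := j.cast_nonneg
  exact ⟨h0, h1, by linarith [h2.1], by linarith [h2.2]⟩

/-- Every zero with `Re ρ ≥ 1/4` and ordinate in `[T'−2, T'+3]` belongs to `nearZeros T'`. [folklore] -/
theorem mem_nearZeros_of {T' : ℝ} {ρ : ℂ} (h0 : riemannZeta ρ = 0) (hre : 1 / 4 ≤ ρ.re)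
    (him : ρ.im ∈ Icc (T' - 2) (T' + 3)) : ρ ∈ nearZeros T' := by
  simp only [nearZeros, Finset.mem_biUnion, Finset.mem_range, Set.Finite.mem_toFinset]
  set d : ℝ := ρ.im - (T' - 2) with hd
  have hd0 : 0 ≤ d := by rw [hd]; linarith [him.1]
  have hd5 : d ≤ 5 := by rw [hd]; linarith [him.2]
  refine ⟨⌊d⌋₊, ?_, h0, hre, ?_⟩
  · have : (⌊d⌋₊ : ℝ) ≤ 5 := (Nat.floor_le hd0).trans hd5
    have h6 : ⌊d⌋₊ ≤ 5 := by exact_mod_cast this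
    omega
  · have h1 : (⌊d⌋₊ : ℝ) ≤ d := Nat.floor_le hd0
    have h2 : d < ⌊d⌋₊ + 1 := Nat.lt_floor_add_one d
    rw [abs_le]
    constructor <;> [skip; skip] <;> rw [hd] at h1 h2 <;> linarith

/-- **`∑_{ρ ∈ nearZeros T'} m(ρ) ≪ log T'`** (six windows, Montgomery–Vaughan Thm. 10.13 through
`exists_sum_zetaZeroWindow_le`): with the window constant `C`, for `T' ≥ 2`,
`∑ m(ρ) ≤ 6 C log(T' + 7)`. [cite: MontgomeryVaughan2007, Thm. 10.13] -/
theorem sum_nearZeros_le {C : ℝ} (hC0 : 0 < C)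
    (hC : ∀ τ : ℝ, ∑ ρ ∈ (zetaZeroWindow_finite τ).toFinset, (riemannZetaZeroOrder ρ : ℝ) ≤
      C * Real.log (|τ| + 2)) {T' : ℝ} (hT' : 2 ≤ T') :
    ∑ ρ ∈ nearZeros T', (riemannZetaZeroOrder ρ : ℝ) ≤ 6 * C * Real.log (T' + 7) := by
  classical
  have hnn : ∀ ρ : ℂ, 0 ≤ (fun ρ : ℂ ↦ if riemannZeta ρ = 0 then (riemannZetaZeroOrder ρ : ℝ) else 0) ρ := by
    intro ρ
    simp only
    split_ifs with h
    · exact riemannZetaZeroOrder_nonneg_of_zero h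
    · exact le_rfl
  -- replace the summand by a globally non-negative one agreeing on zeros
  have heq : ∀ s : Finset ℂ, (∀ ρ ∈ s, riemannZeta ρ = 0) →
      ∑ ρ ∈ s, (riemannZetaZeroOrder ρ : ℝ) =
        ∑ ρ ∈ s, (if riemannZeta ρ = 0 then (riemannZetaZeroOrder ρ : ℝ) else 0) := by
    intro s hs
    exact Finset.sum_congr rfl fun ρ hρ ↦ by rw [if_pos (hs ρ hρ)]
  rw [heq _ fun ρ hρ ↦ (mem_nearZeros hρ).1, nearZeros]
  refine (Literature.Analysis.Complex.HeightAvg.sum_biUnion_le_sum_sum _ _ _ hnn).trans ?_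
  have hlog : ∀ j ∈ Finset.range 6, Real.log (|T' - 3 / 2 + (j : ℝ)| + 2) ≤ Real.log (T' + 7) := by
    intro j hj
    have hj' : (j : ℝ) ≤ 5 := by exact_mod_cast Nat.lt_succ_iff.1 (Finset.mem_range.1 hj)
    have hj0 : (0 : ℝ) ≤ j := j.cast_nonneg
    rw [abs_of_pos (by linarith)]
    exact Real.log_le_log (by linarith) (by linarith)
  calc ∑ j ∈ Finset.range 6, ∑ ρ ∈ (zetaZeroWindow_finite (T' - 3 / 2 + j)).toFinset,
          (if riemannZeta ρ = 0 then (riemannZetaZeroOrder ρ : ℝ) else 0)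
      = ∑ j ∈ Finset.range 6, ∑ ρ ∈ (zetaZeroWindow_finite (T' - 3 / 2 + j)).toFinset,
          (riemannZetaZeroOrder ρ : ℝ) := by
        refine Finset.sum_congr rfl fun j _ ↦ (heq _ fun ρ hρ ↦ ?_).symm
        exact ((Set.Finite.mem_toFinset _).1 hρ).1
    _ ≤ ∑ j ∈ Finset.range 6, C * Real.log (T' + 7) := by
        refine Finset.sum_le_sum fun j hj ↦ (hC _).trans ?_
        exact mul_le_mul_of_nonneg_left (hlog j hj) hC0.le
    _ = 6 * C * Real.log (T' + 7) := by simp; ring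

/-- **Selection of the height.** For every `T'` there is `T ∈ [T', T'+1]` which is not the ordinate
of any `ρ ∈ nearZeros T'` and at which `∑_{ρ ∈ nearZeros T'} m(ρ) |T − γ|^{-1/2} ≤ 8 ∑ m(ρ)`.
[folklore] -/
theorem exists_height (T' : ℝ) :
    ∃ T ∈ Icc T' (T' + 1), (∀ ρ ∈ nearZeros T', ρ.im ≠ T) ∧
      ∑ ρ ∈ nearZeros T', (riemannZetaZeroOrder ρ : ℝ) * |T - ρ.im| ^ (-(1 / 2 : ℝ)) ≤
        8 * ∑ ρ ∈ nearZeros T', (riemannZetaZeroOrder ρ : ℝ) :=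
  Literature.Analysis.Complex.HeightAvg.exists_height_sum_rpow_le T' (nearZeros T')
    (fun ρ ↦ (riemannZetaZeroOrder ρ : ℝ))
    (fun _ hρ ↦ riemannZetaZeroOrder_nonneg_of_zero (mem_nearZeros hρ).1)
    (fun _ hρ ↦ (mem_nearZeros hρ).2.2)

/-! ## The zeros of the disc `|s − (2+iT)| ≤ 37/20` under RH -/

/-- Under RH, a point `u` of the support of the divisor of `ζ` on the disc `|s − (2+iT)| ≤ 37/20`
(`|T| ≥ 2`) is a zero on the critical line with `|Im u − T| ≤ 37/20`, and its divisor value is the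
multiplicity `m(u) ≥ 1`. [folklore] -/
theorem support_divisor_zetaDisc (hRH : RiemannHypothesis) {T : ℝ} (hT : 2 ≤ |T|) {u : ℂ}
    (hu : u ∈ Function.support (divisor riemannZeta (closedBall (2 + T * I) (37 / 20)))) :
    riemannZeta u = 0 ∧ u.re = 1 / 2 ∧ |u.im - T| ≤ 37 / 20 ∧
      (divisor riemannZeta (closedBall (2 + T * I) (37 / 20)) u : ℤ) = riemannZetaZeroOrder u ∧
      0 < riemannZetaZeroOrder u := by
  obtain ⟨h0, hpos, hmem, hre⟩ := zero_of_mem_support_divisor_zetaDisc hT hu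
  have hre' : u.re = 1 / 2 := re_eq_one_half_of_riemannHypothesis hRH h0 (by linarith)
  have hD : (divisor riemannZeta (closedBall (2 + T * I) (37 / 20)) u : ℤ) =
      riemannZetaZeroOrder u :=
    (riemannZetaZeroOrder_eq_divisor (analyticOnNhd_riemannZeta_jensenDisc hT
      (by norm_num)).meromorphicOn hmem).symm
  refine ⟨h0, hre', ?_, hD, by rwa [← hD]⟩
  rw [mem_closedBall, dist_eq_norm] at hmem
  have := abs_im_le_norm (u - (2 + T * I))
  simp only [sub_im, add_im, im_ofNat, mul_im, ofReal_re, I_im, mul_one, ofReal_im, I_re,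
    mul_zero, add_zero, zero_add] at this
  exact this.trans hmem

/-! ## The transport inequality along `[σ, 1/2 + η] + iT` -/

/-- **Transport of `1/ζ` towards the critical line** (Titchmarsh §9.7). Assume RH. Let `|T| ≥ 2`,
`0 < η ≤ 1/8`, `σ ∈ [1/2 − η, 1/2 + η]`, and suppose `T` is not the ordinate of any zero of the
disc `|s − (2+iT)| ≤ 37/20`. Then, with the constant `C₁` of the partial fraction of `ζ'/ζ`,
`‖1/ζ(σ+iT)‖ ≤ ‖1/ζ(1/2+η+iT)‖ · exp(2η C₁ log(|T|+2)) ·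
  exp(2√(2η) ∑_ρ m(ρ) |T − Im ρ|^{-1/2})`, the sum over the zeros of that disc.
[cite: Titchmarsh1986, §9.7 (proof of Thm. 9.7)] -/
theorem norm_inv_zeta_le_transport (hRH : RiemannHypothesis) {C₁ : ℝ}
    (hC₁ : ∀ T : ℝ, 2 ≤ |T| → ∀ z ∈ closedBall (2 + T * I) (7 / 4), riemannZeta z ≠ 0 →
      ‖deriv riemannZeta z / riemannZeta z -
          ∑ u ∈ ((divisor riemannZeta (closedBall (2 + T * I) (37 / 20))).finiteSupport
              (isCompact_closedBall (2 + T * I) (37 / 20))).toFinset,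
            (divisor riemannZeta (closedBall (2 + T * I) (37 / 20)) u : ℂ) / (z - u)‖ ≤
        C₁ * Real.log (|T| + 2))
    {T : ℝ} (hT : 2 ≤ |T|) {η : ℝ} (hη : 0 < η) (hη8 : η ≤ 1 / 8) {σ : ℝ}
    (hσ : σ ∈ Icc (1 / 2 - η) (1 / 2 + η))
    (hord : ∀ u ∈ Function.support (divisor riemannZeta (closedBall (2 + T * I) (37 / 20))),
      u.im ≠ T) :
    ‖(riemannZeta (σ + T * I))⁻¹‖ ≤ ‖(riemannZeta ((1 / 2 + η : ℝ) + T * I))⁻¹‖ *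
      Real.exp (2 * η * (C₁ * Real.log (|T| + 2))) *
      Real.exp (2 * Real.sqrt (2 * η) *
        ∑ u ∈ ((divisor riemannZeta (closedBall (2 + T * I) (37 / 20))).finiteSupport
            (isCompact_closedBall (2 + T * I) (37 / 20))).toFinset,
          (riemannZetaZeroOrder u : ℝ) * |T - u.im| ^ (-(1 / 2 : ℝ))) := by
  classical
  set D := divisor riemannZeta (closedBall (2 + (T : ℂ) * I) (37 / 20)) with hDdef
  set Z : Finset ℂ := (D.finiteSupport (isCompact_closedBall (2 + (T : ℂ) * I) (37 / 20))).toFinset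
    with hZdef
  have hZ : ∀ u ∈ Z, u ∈ Function.support D := fun u hu ↦ (Set.Finite.mem_toFinset _).1 hu
  -- data of the zeros of the disc
  have hZspec : ∀ u ∈ Z, riemannZeta u = 0 ∧ u.re = 1 / 2 ∧ |u.im - T| ≤ 37 / 20 ∧
      (D u : ℤ) = riemannZetaZeroOrder u ∧ 0 < riemannZetaZeroOrder u := fun u hu ↦
    support_divisor_zetaDisc hRH hT (hZ u hu)
  set m : ℂ → ℕ := fun u ↦ (riemannZetaZeroOrder u).toNat with hmdef
  have hm : ∀ u ∈ Z, ((m u : ℕ) : ℤ) = D u := by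
    intro u hu
    rw [hmdef, (hZspec u hu).2.2.2.1]
    exact Int.toNat_of_nonneg (hZspec u hu).2.2.2.2.le
  have hmR : ∀ u ∈ Z, ((m u : ℕ) : ℝ) = (riemannZetaZeroOrder u : ℝ) := by
    intro u hu
    have := hm u hu
    rw [(hZspec u hu).2.2.2.1] at this
    exact_mod_cast this
  -- points of the segment
  set σ₁ : ℝ := 1 / 2 + η with hσ₁
  have hσσ₁ : σ ≤ σ₁ := by rw [hσ₁]; exact hσ.2
  have hT0 : T ≠ 0 := fun h ↦ by rw [h, abs_zero] at hT; linarith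
  have hseg : ∀ v ∈ Icc σ σ₁, ((v : ℂ) + T * I) ∈ closedBall (2 + (T : ℂ) * I) (7 / 4) ∧
      ((v : ℂ) + T * I) ≠ 1 ∧ riemannZeta (v + T * I) ≠ 0 ∧ ∀ u ∈ Z, ((v : ℂ) + T * I) ≠ u := by
    intro v hv
    have hv1 : 1 / 4 ≤ v := by linarith [hv.1, hσ.1]
    have hv2 : v ≤ 2 := by linarith [hv.2, hσ.2]
    refine ⟨?_, ?_, ?_, ?_⟩
    · rw [mem_closedBall, dist_eq_norm,
        show (v : ℂ) + T * I - (2 + T * I) = ((v - 2 : ℝ) : ℂ) by push_cast; ring,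
        Complex.norm_real, Real.norm_eq_abs, abs_le]
      constructor <;> linarith
    · intro h
      have := congrArg Complex.im h
      simp at this
      exact hT0 this
    · intro h0
      -- a zero `v + iT` is on the line and in the disc, contradicting `hord`
      have hre : ((v : ℂ) + T * I).re = 1 / 2 :=
        re_eq_one_half_of_riemannHypothesis hRH h0 (by simp; linarith)
      have hmem : ((v : ℂ) + T * I) ∈ closedBall (2 + (T : ℂ) * I) (37 / 20) := by
        rw [mem_closedBall, dist_eq_norm,
          show (v : ℂ) + T * I - (2 + T * I) = ((v - 2 : ℝ) : ℂ) by push_cast; ring,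
          Complex.norm_real, Real.norm_eq_abs, abs_le]
        constructor <;> linarith
      have hsupp : ((v : ℂ) + T * I) ∈ Function.support D := by
        rw [Function.mem_support, hDdef,
          ← riemannZetaZeroOrder_eq_divisor (analyticOnNhd_riemannZeta_jensenDisc hT
            (by norm_num)).meromorphicOn hmem]
        exact ((riemannZetaZeroOrder_pos_iff (ne_one_of_riemannZeta_eq_zero h0)).2 h0).ne'
      exact hord _ hsupp (by simp)
    · intro u hu h
      exact hord u (hZ u hu) (by rw [← h]; simp)
  -- the polynomial `P` and the function `G = ζ/P`
  set pf : ℂ → ℂ → ℂ := fun u z ↦ (z - u) ^ (m u) with hpf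
  set P : ℂ → ℂ := fun z ↦ ∏ u ∈ Z, pf u z with hPdef
  set G : ℂ → ℂ := fun z ↦ riemannZeta z / P z with hGdef
  have hPne : ∀ v ∈ Icc σ σ₁, P (v + T * I) ≠ 0 := by
    intro v hv
    rw [hPdef]
    simp only [hpf]
    rw [Finset.prod_ne_zero_iff]
    exact fun u hu ↦ pow_ne_zero _ (sub_ne_zero.2 ((hseg v hv).2.2.2 u hu))
  have hpfdiff : ∀ u : ℂ, ∀ z : ℂ, DifferentiableAt ℂ (pf u) z := fun u z ↦ by
    simp only [hpf]; fun_prop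
  have hPdiff : ∀ z : ℂ, DifferentiableAt ℂ P z := fun z ↦
    DifferentiableAt.fun_finsetProd (f := pf) fun u _ ↦ hpfdiff u z
  have hGdiff : ∀ v ∈ Icc σ σ₁, DifferentiableAt ℂ G (v + T * I) := fun v hv ↦
    (differentiableAt_riemannZeta (hseg v hv).2.1).div (hPdiff _) (hPne v hv)
  have hGne : ∀ v ∈ Icc σ σ₁, G (v + T * I) ≠ 0 := fun v hv ↦
    div_ne_zero (hseg v hv).2.2.1 (hPne v hv)
  -- the logarithmic derivative of `G` is the partial-fraction remainder
  have hlogP : ∀ v ∈ Icc σ σ₁, logDeriv P (v + T * I) = ∑ u ∈ Z, (D u : ℂ) / ((v : ℂ) + T * I - u) := by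
    intro v hv
    have hne := (hseg v hv).2.2.2
    have h1 : logDeriv P (v + T * I) = ∑ u ∈ Z, logDeriv (pf u) (v + T * I) :=
      logDeriv_prod (f := pf) (fun u hu ↦ by
        simp only [hpf]; exact pow_ne_zero _ (sub_ne_zero.2 (hne u hu))) (fun u _ ↦ hpfdiff u _)
    rw [h1]
    refine Finset.sum_congr rfl fun u hu ↦ ?_
    have h2 : logDeriv (pf u) (v + T * I) = (m u : ℂ) * logDeriv (fun z : ℂ ↦ z - u) (v + T * I) := by
      simp only [hpf]
      exact logDeriv_fun_pow (f := fun z : ℂ ↦ z - u) (by fun_prop) (m u)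
    have h3 : logDeriv (fun z : ℂ ↦ z - u) ((v : ℂ) + T * I) = 1 / ((v : ℂ) + T * I - u) := by
      rw [logDeriv_apply, deriv_sub_const, deriv_id'']
    rw [h2, h3, ← hm u hu]
    push_cast
    ring
  have hlogG : ∀ v ∈ Icc σ σ₁, ‖deriv G (v + T * I) / G (v + T * I)‖ ≤ C₁ * Real.log (|T| + 2) := by
    intro v hv
    have h1 : deriv G (v + T * I) / G (v + T * I) = logDeriv G (v + T * I) := (logDeriv_apply _ _).symm
    rw [h1, hGdef, logDeriv_div _ (hseg v hv).2.2.1 (hPne v hv)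
      (differentiableAt_riemannZeta (hseg v hv).2.1) (hPdiff _), logDeriv_apply, hlogP v hv]
    exact hC₁ T hT _ (hseg v hv).1 (hseg v hv).2.2.1
  -- Grönwall
  have hGr := norm_inv_le_norm_inv_mul_exp (f := G) (t := T) (M := C₁ * Real.log (|T| + 2)) hσσ₁
    hGdiff hGne hlogG
  -- unfold `G`
  have hGinv : ∀ v ∈ Icc σ σ₁, ‖(G (v + T * I))⁻¹‖ = ‖P (v + T * I)‖ * ‖(riemannZeta (v + T * I))⁻¹‖ := by
    intro v hv
    simp only [hGdef]
    rw [norm_inv, norm_inv, norm_div, inv_div, div_eq_mul_inv]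
  rw [hGinv σ ⟨le_rfl, hσσ₁⟩, hGinv σ₁ ⟨hσσ₁, le_rfl⟩] at hGr
  -- norms of `P`
  have hPnorm : ∀ v : ℝ, ‖P (v + T * I)‖ = ∏ u ∈ Z, ‖(v : ℂ) + T * I - u‖ ^ (m u) := by
    intro v
    rw [hPdef]
    simp only [hpf, norm_prod, norm_pow]
  have hPpos : 0 < ‖P (σ + T * I)‖ := norm_pos_iff.2 (hPne σ ⟨le_rfl, hσσ₁⟩)
  -- the ratio of the two products
  have hlog0 : 0 ≤ C₁ * Real.log (|T| + 2) := by
    have h1 := hC₁ T hT _ (hseg σ ⟨le_rfl, hσσ₁⟩).1 (hseg σ ⟨le_rfl, hσσ₁⟩).2.2.1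
    exact (norm_nonneg _).trans h1
  have hexp1 : Real.exp (C₁ * Real.log (|T| + 2) * (σ₁ - σ)) ≤
      Real.exp (2 * η * (C₁ * Real.log (|T| + 2))) := by
    refine Real.exp_le_exp.2 ?_
    have : σ₁ - σ ≤ 2 * η := by rw [hσ₁]; linarith [hσ.1]
    nlinarith
  have hratio : ‖P (σ₁ + T * I)‖ / ‖P (σ + T * I)‖ ≤
      Real.exp (2 * Real.sqrt (2 * η) * ∑ u ∈ Z, (riemannZetaZeroOrder u : ℝ) * |T - u.im| ^ (-(1 / 2 : ℝ))) := by
    rw [hPnorm, hPnorm, ← Finset.prod_div_distrib, Finset.mul_sum, Real.exp_sum]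
    refine Finset.prod_le_prod (fun u _ ↦ by positivity) fun u hu ↦ ?_
    obtain ⟨-, hure, -, -, -⟩ := hZspec u hu
    have hd : 0 < |T - u.im| := abs_pos.2 (sub_ne_zero.2 (Ne.symm (hord u (hZ u hu))))
    have hlow : |T - u.im| ≤ ‖(σ : ℂ) + T * I - u‖ := by
      have := abs_im_le_norm ((σ : ℂ) + T * I - u)
      simpa using this
    have hpos : 0 < ‖(σ : ℂ) + T * I - u‖ := hd.trans_le hlow
    have hup : ‖(σ₁ : ℂ) + T * I - u‖ ≤ ‖(σ : ℂ) + T * I - u‖ + 2 * η := by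
      have e : (σ₁ : ℂ) + T * I - u = ((σ : ℂ) + T * I - u) + ((σ₁ - σ : ℝ) : ℂ) := by
        push_cast; ring
      rw [e]
      refine (norm_add_le _ _).trans ?_
      rw [Complex.norm_real, Real.norm_eq_abs, abs_of_nonneg (by linarith)]
      have : σ₁ - σ ≤ 2 * η := by rw [hσ₁]; linarith [hσ.1]
      linarith
    rw [← div_pow]
    have hq : ‖(σ₁ : ℂ) + T * I - u‖ / ‖(σ : ℂ) + T * I - u‖ ≤ 1 + 2 * η / |T - u.im| := by
      rw [div_le_iff₀ hpos]
      have h2 : 2 * η / |T - u.im| * ‖(σ : ℂ) + T * I - u‖ ≥ 2 * η := by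
        rw [ge_iff_le, div_mul_eq_mul_div, le_div_iff₀ hd]
        nlinarith
      nlinarith
    have hy : 0 ≤ 2 * η / |T - u.im| := by positivity
    calc (‖(σ₁ : ℂ) + T * I - u‖ / ‖(σ : ℂ) + T * I - u‖) ^ m u
        ≤ (1 + 2 * η / |T - u.im|) ^ m u := pow_le_pow_left₀ (by positivity) hq _
      _ ≤ Real.exp (2 * (m u) * Real.sqrt (2 * η / |T - u.im|)) :=
          Literature.Analysis.Complex.HeightAvg.one_add_pow_le_exp hy (m u)
      _ = Real.exp (2 * Real.sqrt (2 * η) * ((riemannZetaZeroOrder u : ℝ) * |T - u.im| ^ (-(1 / 2 : ℝ)))) := by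
          rw [Literature.Analysis.Complex.HeightAvg.sqrt_div_eq_mul_rpow (by positivity) hd, ← hmR u hu]
          ring_nf
  -- assemble
  set M : ℝ := C₁ * Real.log (|T| + 2) with hM
  set S : ℝ := ∑ u ∈ Z, (riemannZetaZeroOrder u : ℝ) * |T - u.im| ^ (-(1 / 2 : ℝ)) with hS
  have h1 : ‖(riemannZeta (σ + T * I))⁻¹‖ =
      (‖P (σ + T * I)‖ * ‖(riemannZeta (σ + T * I))⁻¹‖) / ‖P (σ + T * I)‖ := by
    field_simp
  have h2 := div_le_div_of_nonneg_right hGr hPpos.le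
  have h3 : ‖P (σ₁ + T * I)‖ * ‖(riemannZeta (σ₁ + T * I))⁻¹‖ * Real.exp (M * (σ₁ - σ)) /
      ‖P (σ + T * I)‖ = ‖(riemannZeta (σ₁ + T * I))⁻¹‖ *
        (‖P (σ₁ + T * I)‖ / ‖P (σ + T * I)‖) * Real.exp (M * (σ₁ - σ)) := by ring
  have hinv0 : 0 ≤ ‖(riemannZeta (σ₁ + T * I))⁻¹‖ := norm_nonneg _
  calc ‖(riemannZeta (σ + T * I))⁻¹‖
      = (‖P (σ + T * I)‖ * ‖(riemannZeta (σ + T * I))⁻¹‖) / ‖P (σ + T * I)‖ := h1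
    _ ≤ ‖P (σ₁ + T * I)‖ * ‖(riemannZeta (σ₁ + T * I))⁻¹‖ * Real.exp (M * (σ₁ - σ)) /
          ‖P (σ + T * I)‖ := h2
    _ = ‖(riemannZeta (σ₁ + T * I))⁻¹‖ * (‖P (σ₁ + T * I)‖ / ‖P (σ + T * I)‖) *
          Real.exp (M * (σ₁ - σ)) := h3
    _ ≤ ‖(riemannZeta (σ₁ + T * I))⁻¹‖ * Real.exp (2 * Real.sqrt (2 * η) * S) *
          Real.exp (2 * η * M) := by gcongr
    _ = ‖(riemannZeta (σ₁ + T * I))⁻¹‖ * Real.exp (2 * η * M) *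
          Real.exp (2 * Real.sqrt (2 * η) * S) := by ring

/-! ## The core: `|σ − 1/2| ≤ η` -/

/-- Exponent bookkeeping: for `T ≥ 8`, `0 ≤ a, b ≤ ε/4`:
`T^{ε/3} (T+2)^a (T+7)^b ≤ T^ε`. [folklore] -/
theorem rpow_bookkeeping {T ε a b : ℝ} (hT : 8 ≤ T) (hε : 0 < ε) (ha0 : 0 ≤ a) (ha : a ≤ ε / 4)
    (hb0 : 0 ≤ b) (hb : b ≤ ε / 4) :
    T ^ (ε / 3) * (T + 2) ^ a * (T + 7) ^ b ≤ T ^ ε := by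
  have hT0 : 0 < T := by linarith
  have h2T : (1 : ℝ) ≤ 2 * T := by linarith
  have hA : (T + 2) ^ a ≤ (2 : ℝ) ^ (ε / 4) * T ^ (ε / 4) := by
    calc (T + 2) ^ a ≤ (2 * T) ^ a := Real.rpow_le_rpow (by linarith) (by linarith) ha0
      _ ≤ (2 * T) ^ (ε / 4) := Real.rpow_le_rpow_of_exponent_le h2T ha
      _ = 2 ^ (ε / 4) * T ^ (ε / 4) := Real.mul_rpow (by norm_num) hT0.le
  have hB : (T + 7) ^ b ≤ (2 : ℝ) ^ (ε / 4) * T ^ (ε / 4) := by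
    calc (T + 7) ^ b ≤ (2 * T) ^ b := Real.rpow_le_rpow (by linarith) (by linarith) hb0
      _ ≤ (2 * T) ^ (ε / 4) := Real.rpow_le_rpow_of_exponent_le h2T hb
      _ = 2 ^ (ε / 4) * T ^ (ε / 4) := Real.mul_rpow (by norm_num) hT0.le
  have h8 : (2 : ℝ) ^ (ε / 4) * 2 ^ (ε / 4) ≤ T ^ (ε / 6) := by
    rw [← Real.rpow_add two_pos, show ε / 4 + ε / 4 = 3 * (ε / 6) by ring, Real.rpow_mul (by norm_num)]
    have : (2 : ℝ) ^ (3 : ℝ) = 8 := by norm_num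
    rw [this]
    exact Real.rpow_le_rpow (by norm_num) hT (by positivity)
  have hpos : ∀ e : ℝ, 0 ≤ T ^ e := fun e ↦ Real.rpow_nonneg hT0.le e
  calc T ^ (ε / 3) * (T + 2) ^ a * (T + 7) ^ b
      ≤ T ^ (ε / 3) * ((2 : ℝ) ^ (ε / 4) * T ^ (ε / 4)) * ((2 : ℝ) ^ (ε / 4) * T ^ (ε / 4)) := by
        gcongr
    _ = ((2 : ℝ) ^ (ε / 4) * 2 ^ (ε / 4)) * (T ^ (ε / 3) * T ^ (ε / 4) * T ^ (ε / 4)) := by ring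
    _ ≤ T ^ (ε / 6) * (T ^ (ε / 3) * T ^ (ε / 4) * T ^ (ε / 4)) :=
        mul_le_mul_of_nonneg_right h8 (by positivity)
    _ = T ^ ε := by
        rw [← Real.rpow_add hT0, ← Real.rpow_add hT0, ← Real.rpow_add hT0]; ring_nf

/-- **The core step.** Under RH, for `ε > 0` there are `η ∈ (0, 1/8]` and `T₀` such that every
interval `[T', T'+1]`, `T' ≥ T₀`, contains a `T`, not the ordinate of any zero of `nearZeros T'`,
with `‖1/ζ(σ + iT)‖ ≤ T^ε` for all `σ ∈ [1/2 − η, 1/2 + η]` (transport from `σ₁ = 1/2 + η`, where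
Littlewood's bound holds, at a height selected by averaging). [cite: Titchmarsh1986, Thm. 14.16] -/
theorem exists_height_core (hRH : RiemannHypothesis) {ε : ℝ} (hε : 0 < ε) :
    ∃ η : ℝ, 0 < η ∧ η ≤ 1 / 8 ∧ ∃ T₀ : ℝ, 8 ≤ T₀ ∧ ∀ T' : ℝ, T₀ ≤ T' →
      ∃ T ∈ Icc T' (T' + 1), (∀ ρ ∈ nearZeros T', ρ.im ≠ T) ∧
        ∀ σ ∈ Icc (1 / 2 - η) (1 / 2 + η), ‖(riemannZeta (σ + T * I))⁻¹‖ ≤ T ^ ε := by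
  classical
  obtain ⟨C₁, hC₁0, hC₁⟩ := exists_norm_logDeriv_zeta_sub_sum_le
  obtain ⟨C₂, hC₂0, hC₂⟩ := exists_sum_zetaZeroWindow_le
  -- choice of `η`
  set η : ℝ := min (1 / 8) (min (ε / (8 * C₁)) ((ε / (384 * Real.sqrt 2 * C₂)) ^ 2)) with hηdef
  have hη0 : 0 < η := by
    rw [hηdef]
    refine lt_min (by norm_num) (lt_min (by positivity) (by positivity))
  have hη8 : η ≤ 1 / 8 := min_le_left _ _
  have hηa : 2 * η * C₁ ≤ ε / 4 := by
    have : η ≤ ε / (8 * C₁) := (min_le_right _ _).trans (min_le_left _ _)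
    rw [le_div_iff₀ (by positivity)] at this
    linarith
  have hηb : 96 * Real.sqrt 2 * C₂ * Real.sqrt η ≤ ε / 4 := by
    have h1 : η ≤ (ε / (384 * Real.sqrt 2 * C₂)) ^ 2 := (min_le_right _ _).trans (min_le_right _ _)
    have h2 : Real.sqrt η ≤ ε / (384 * Real.sqrt 2 * C₂) := by
      rw [← Real.sqrt_sq (show (0:ℝ) ≤ ε / (384 * Real.sqrt 2 * C₂) by positivity)]
      exact Real.sqrt_le_sqrt h1
    have h3 : 0 < 384 * Real.sqrt 2 * C₂ := by positivity
    rw [le_div_iff₀ h3] at h2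
    nlinarith [Real.sqrt_nonneg η]
  -- Littlewood at `σ₁ = 1/2 + η`
  obtain ⟨T_L, hT_L⟩ := InvZetaRH.norm_inv_riemannZeta_le_rpow hRH (σ₀ := 1 / 2 + η)
    (by linarith) (ε := ε / 3) (by positivity)
  refine ⟨η, hη0, hη8, max 8 T_L, le_max_left _ _, fun T' hT' ↦ ?_⟩
  have hT'8 : 8 ≤ T' := (le_max_left _ _).trans hT'
  have hT'L : T_L ≤ T' := (le_max_right _ _).trans hT'
  obtain ⟨T, hTI, hTord, hΦ⟩ := exists_height T'
  have hT8 : 8 ≤ T := hT'8.trans hTI.1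
  have hT0 : 0 < T := by linarith
  have hTabs : |T| = T := abs_of_pos hT0
  have hT2 : 2 ≤ |T| := by rw [hTabs]; linarith
  refine ⟨T, hTI, hTord, fun σ hσ ↦ ?_⟩
  -- the zeros of the disc at height `T` are in `nearZeros T'`
  have hdisc : ∀ u ∈ Function.support (divisor riemannZeta (closedBall (2 + (T : ℂ) * I) (37 / 20))),
      u ∈ nearZeros T' := by
    intro u hu
    obtain ⟨h0, hre, him, -, -⟩ := support_divisor_zetaDisc hRH hT2 hu
    refine mem_nearZeros_of h0 (by rw [hre]; norm_num) ?_
    rw [abs_le] at him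
    exact ⟨by linarith [hTI.1], by linarith [hTI.2]⟩
  have hord : ∀ u ∈ Function.support (divisor riemannZeta (closedBall (2 + (T : ℂ) * I) (37 / 20))),
      u.im ≠ T := fun u hu ↦ hTord u (hdisc u hu)
  have htr := norm_inv_zeta_le_transport hRH hC₁ hT2 hη0 hη8 hσ hord
  -- the sum over the disc is at most `8 ∑ m ≤ 48 C₂ log(T'+7)`
  set Z := ((divisor riemannZeta (closedBall (2 + (T : ℂ) * I) (37 / 20))).finiteSupport
    (isCompact_closedBall (2 + (T : ℂ) * I) (37 / 20))).toFinset with hZ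
  have hZsub : Z ⊆ nearZeros T' := fun u hu ↦ hdisc u ((Set.Finite.mem_toFinset _).1 hu)
  have hS : ∑ u ∈ Z, (riemannZetaZeroOrder u : ℝ) * |T - u.im| ^ (-(1 / 2 : ℝ)) ≤
      48 * C₂ * Real.log (T + 7) := by
    have h1 : ∑ u ∈ Z, (riemannZetaZeroOrder u : ℝ) * |T - u.im| ^ (-(1 / 2 : ℝ)) ≤
        ∑ ρ ∈ nearZeros T', (riemannZetaZeroOrder ρ : ℝ) * |T - ρ.im| ^ (-(1 / 2 : ℝ)) :=
      Finset.sum_le_sum_of_subset_of_nonneg hZsub fun ρ hρ _ ↦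
        mul_nonneg (riemannZetaZeroOrder_nonneg_of_zero (mem_nearZeros hρ).1)
          (Real.rpow_nonneg (abs_nonneg _) _)
    have h2 := sum_nearZeros_le hC₂0 hC₂ (T' := T') (by linarith)
    have h3 : Real.log (T' + 7) ≤ Real.log (T + 7) :=
      Real.log_le_log (by linarith) (by linarith [hTI.1])
    calc _ ≤ _ := h1
      _ ≤ 8 * ∑ ρ ∈ nearZeros T', (riemannZetaZeroOrder ρ : ℝ) := hΦ
      _ ≤ 8 * (6 * C₂ * Real.log (T' + 7)) := by linarith
      _ ≤ 48 * C₂ * Real.log (T + 7) := by nlinarith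
  -- Littlewood
  have hLw : ‖(riemannZeta (((1 / 2 + η : ℝ) : ℂ) + T * I))⁻¹‖ ≤ T ^ (ε / 3) := by
    have := hT_L (1 / 2 + η) T le_rfl (by rw [hTabs]; linarith [hTI.1])
    rwa [hTabs] at this
  -- the two exponential factors as powers
  have hE1 : Real.exp (2 * η * (C₁ * Real.log (|T| + 2))) = (T + 2) ^ (2 * η * C₁) := by
    rw [hTabs, Real.rpow_def_of_pos (by linarith), mul_comm (Real.log (T + 2))]; ring_nf
  have hE2 : Real.exp (2 * Real.sqrt (2 * η) *
      ∑ u ∈ Z, (riemannZetaZeroOrder u : ℝ) * |T - u.im| ^ (-(1 / 2 : ℝ))) ≤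
      (T + 7) ^ (96 * Real.sqrt 2 * C₂ * Real.sqrt η) := by
    rw [Real.rpow_def_of_pos (by linarith)]
    refine Real.exp_le_exp.2 ?_
    have hsq : Real.sqrt (2 * η) = Real.sqrt 2 * Real.sqrt η := Real.sqrt_mul (by norm_num) η
    rw [hsq]
    have h0 : 0 ≤ 2 * (Real.sqrt 2 * Real.sqrt η) := by positivity
    have := mul_le_mul_of_nonneg_left hS h0
    nlinarith [Real.log_nonneg (show (1:ℝ) ≤ T + 7 by linarith), Real.sqrt_nonneg 2,
      Real.sqrt_nonneg η]
  have hbk := rpow_bookkeeping hT8 hε (by positivity) hηa (by positivity) hηb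
  calc ‖(riemannZeta (σ + T * I))⁻¹‖
      ≤ ‖(riemannZeta (((1 / 2 + η : ℝ) : ℂ) + T * I))⁻¹‖ *
          Real.exp (2 * η * (C₁ * Real.log (|T| + 2))) *
          Real.exp (2 * Real.sqrt (2 * η) *
            ∑ u ∈ Z, (riemannZetaZeroOrder u : ℝ) * |T - u.im| ^ (-(1 / 2 : ℝ))) := htr
    _ ≤ T ^ (ε / 3) * (T + 2) ^ (2 * η * C₁) * (T + 7) ^ (96 * Real.sqrt 2 * C₂ * Real.sqrt η) := by
        rw [hE1]
        gcongr
    _ ≤ T ^ ε := hbk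

/-! ## The functional equation on the left, Littlewood on the right -/

/-- The factor of the functional equation is bounded below on `1/2 ≤ Re s ≤ 1`, `|Im s| ≥ 1`:
`‖2 (2π)^{-s} Γ(s) cos(πs/2)‖ ≥ 1/(30π)`. [folklore] -/
theorem norm_fe_factor_ge {s : ℂ} (h1 : 1 / 2 ≤ s.re) (h2 : s.re ≤ 1) (ht : 1 ≤ |s.im|) :
    1 / (30 * π) ≤ ‖2 * (2 * (π : ℂ)) ^ (-s) * Complex.Gamma s * Complex.cos (π * s / 2)‖ := by
  have hπ := Real.pi_gt_three
  have hs : s = (s.re : ℂ) + (s.im : ℂ) * I := (Complex.re_add_im s).symm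
  -- `‖(2π)^{-s}‖ ≥ (2π)^{-1}`
  have hpow : (2 * π)⁻¹ ≤ ‖(2 * (π : ℂ)) ^ (-s)‖ := by
    rw [show (2 * (π : ℂ)) = ((2 * π : ℝ) : ℂ) by push_cast; ring,
      Complex.norm_cpow_eq_rpow_re_of_pos (by positivity), neg_re, ← Real.rpow_neg_one]
    exact Real.rpow_le_rpow_of_exponent_le (by linarith) (by linarith)
  -- `‖Γ(s)‖ ≥ (2/15) e^{-π|t|/2}`
  have hG : 2 / 15 * Real.exp (-(π * |s.im|) / 2) ≤ ‖Complex.Gamma s‖ := by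
    have := Literature.Analysis.SpecialFunctions.norm_Gamma_ge_exp (x := s.re) h1 (by linarith) s.im
    rwa [← hs] at this
  -- `‖cos(πs/2)‖ ≥ sinh(π|t|/2) ≥ e^{π|t|/2}/4`
  have hcos : Real.exp (π * |s.im| / 2) / 4 ≤ ‖Complex.cos (π * s / 2)‖ := by
    have h := Literature.Analysis.SpecialFunctions.abs_sinh_im_le_norm_cos (π * s / 2)
    have him : (π * s / 2 : ℂ).im = π * s.im / 2 := by simp [mul_im, div_ofNat_im]
    rw [him] at h
    have habs : |Real.sinh (π * s.im / 2)| = Real.sinh (π * |s.im| / 2) := by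
      rcases le_or_gt 0 s.im with h0 | h0
      · rw [abs_of_nonneg h0, abs_of_nonneg (Real.sinh_nonneg_iff.2 (by positivity))]
      · rw [abs_of_neg h0, abs_of_neg (Real.sinh_neg_iff.2 (by nlinarith)), ← Real.sinh_neg]
        ring_nf
    rw [habs] at h
    have hsinh := Literature.Analysis.SpecialFunctions.exp_le_four_mul_sinh (u := π * |s.im| / 2)
      (by nlinarith)
    linarith
  have hE : Real.exp (-(π * |s.im|) / 2) * Real.exp (π * |s.im| / 2) = 1 := by
    rw [← Real.exp_add]; convert Real.exp_zero using 2; ring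
  calc 1 / (30 * π) = (Real.exp (-(π * |s.im|) / 2) * Real.exp (π * |s.im| / 2)) / (30 * π) := by
        rw [hE]
    _ = 2 * (2 * π)⁻¹ * (2 / 15 * Real.exp (-(π * |s.im|) / 2)) *
        (Real.exp (π * |s.im| / 2) / 4) := by
        field_simp
        ring
    _ ≤ 2 * ‖(2 * (π : ℂ)) ^ (-s)‖ * ‖Complex.Gamma s‖ * ‖Complex.cos (π * s / 2)‖ := by
        gcongr
    _ = ‖2 * (2 * (π : ℂ)) ^ (-s) * Complex.Gamma s * Complex.cos (π * s / 2)‖ := by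
        simp only [norm_mul, Complex.norm_ofNat]

/-- Under RH, `‖1/ζ(σ + iT)‖ ≤ 30π ‖1/ζ((1−σ) − iT)‖` for `0 ≤ σ ≤ 1/2`, `|T| ≥ 1`
(functional equation and `norm_fe_factor_ge`). [folklore] -/
theorem norm_inv_zeta_le_of_re_le_half {σ T : ℝ} (h0 : 0 ≤ σ) (h1 : σ ≤ 1 / 2) (hT : 1 ≤ |T|) :
    ‖(riemannZeta (σ + T * I))⁻¹‖ ≤
      30 * π * ‖(riemannZeta (((1 - σ : ℝ) : ℂ) + (-T) * I))⁻¹‖ := by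
  have hπ := Real.pi_gt_three
  set s : ℂ := ((1 - σ : ℝ) : ℂ) + (-T) * I with hs
  have hsre : s.re = 1 - σ := by simp [hs]
  have hsim : s.im = -T := by simp [hs]
  have hT0 : T ≠ 0 := fun h ↦ by rw [h, abs_zero] at hT; linarith
  have hsn : ∀ n : ℕ, s ≠ -n := by
    intro n h
    have := congrArg Complex.im h
    simp [hsim] at this
    exact hT0 this
  have hs1 : s ≠ 1 := by
    intro h
    have := congrArg Complex.im h
    simp [hsim] at this
    exact hT0 this
  have hfe := riemannZeta_one_sub hsn hs1
  have e : 1 - s = (σ : ℂ) + T * I := by rw [hs]; push_cast; ring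
  rw [e] at hfe
  have hfac := norm_fe_factor_ge (s := s) (by rw [hsre]; linarith) (by rw [hsre]; linarith)
    (by rw [hsim, abs_neg]; exact hT)
  have hfac0 : 0 < ‖2 * (2 * (π : ℂ)) ^ (-s) * Complex.Gamma s * Complex.cos (π * s / 2)‖ :=
    lt_of_lt_of_le (by positivity) hfac
  rw [hfe, mul_inv, norm_mul, norm_inv]
  refine mul_le_mul_of_nonneg_right ?_ (norm_nonneg _)
  rw [inv_le_comm₀ hfac0 (by positivity), ← one_div]
  exact hfac

/-- **`1/ζ(σ ± iT) ≪ T^ε` across `1/4 ≤ σ ≤ 2` at very good heights, under RH** (Titchmarsh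
Thm. 14.16 / Montgomery–Vaughan Thm. 13.22 on `[1/4, 2]`). Assume RH and let `ε > 0`. There is
`T₀ ≥ 2` such that for every `T' ≥ T₀` some `T ∈ [T', T'+1]` satisfies: `T` and `−T` are not
ordinates of zeros `β + iγ` with `β ≥ 1/4`, and `‖1/ζ(σ + iT)‖ ≤ T^ε`, `‖1/ζ(σ − iT)‖ ≤ T^ε` for all
`σ ∈ [1/4, 2]`. [cite: Titchmarsh1986, Thm. 14.16] -/
theorem exists_norm_inv_zeta_le_rpow (hRH : RiemannHypothesis) {ε : ℝ} (hε : 0 < ε) :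
    ∃ T₀ : ℝ, 2 ≤ T₀ ∧ ∀ T' : ℝ, T₀ ≤ T' → ∃ T ∈ Icc T' (T' + 1),
      (∀ ρ : ℂ, riemannZeta ρ = 0 → 1 / 4 ≤ ρ.re → ρ.im ≠ T ∧ ρ.im ≠ -T) ∧
      ∀ σ ∈ Icc (1 / 4 : ℝ) 2,
        ‖(riemannZeta (σ + T * I))⁻¹‖ ≤ T ^ ε ∧ ‖(riemannZeta (σ - T * I))⁻¹‖ ≤ T ^ ε := by
  have hπ := Real.pi_gt_three
  obtain ⟨η, hη0, hη8, T₀, hT₀8, hcore⟩ := exists_height_core hRH hε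
  obtain ⟨T₁, hT₁⟩ := InvZetaRH.norm_inv_riemannZeta_le_rpow hRH (σ₀ := 1 / 2 + η)
    (by linarith) hε
  obtain ⟨T₂, hT₂⟩ := InvZetaRH.norm_inv_riemannZeta_le_rpow hRH (σ₀ := 1 / 2 + η)
    (by linarith) (ε := ε / 3) (by positivity)
  -- `30π ≤ T^{2ε/3}` for large `T`
  obtain ⟨T₃, hT₃⟩ : ∃ T₃ : ℝ, ∀ T : ℝ, T₃ ≤ T → 30 * π ≤ T ^ (2 * ε / 3) := by
    have h := (tendsto_rpow_atTop (by positivity : 0 < 2 * ε / 3)).eventually_ge_atTop (30 * π)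
    exact Filter.eventually_atTop.1 h
  refine ⟨max (max T₀ T₁) (max T₂ T₃), le_trans (by linarith) (le_max_of_le_left (le_max_left _ _)),
    fun T' hT' ↦ ?_⟩
  have h0 : T₀ ≤ T' := le_trans (le_max_left _ _) ((le_max_left _ _).trans hT')
  have h1 : T₁ ≤ T' := le_trans (le_max_right _ _) ((le_max_left _ _).trans hT')
  have h2 : T₂ ≤ T' := le_trans (le_max_left _ _) ((le_max_right _ _).trans hT')
  have h3 : T₃ ≤ T' := le_trans (le_max_right _ _) ((le_max_right _ _).trans hT')
  obtain ⟨T, hTI, hTord, hTcore⟩ := hcore T' h0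
  have hT8 : 8 ≤ T := hT₀8.trans (h0.trans hTI.1)
  have hTpos : 0 < T := by linarith
  have hTabs : |T| = T := abs_of_pos hTpos
  have hTabs' : |-T| = T := by rw [abs_neg, hTabs]
  -- `T` and `-T` are not ordinates
  have hnot : ∀ ρ : ℂ, riemannZeta ρ = 0 → 1 / 4 ≤ ρ.re → ρ.im ≠ T ∧ ρ.im ≠ -T := by
    intro ρ hρ0 hρre
    constructor
    · intro h
      refine hTord ρ (mem_nearZeros_of hρ0 hρre ?_) h
      rw [h]; exact ⟨by linarith [hTI.1], by linarith [hTI.2]⟩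
    · intro h
      have hc0 : riemannZeta (conj ρ) = 0 := by rw [riemannZeta_conj, hρ0, map_zero]
      have him : (conj ρ).im = T := by rw [Complex.conj_im, h, neg_neg]
      refine hTord (conj ρ) (mem_nearZeros_of hc0 (by simpa using hρre) ?_) him
      rw [him]
      exact ⟨by linarith [hTI.1], by linarith [hTI.2]⟩
  refine ⟨T, hTI, hnot, fun σ hσ ↦ ?_⟩
  -- the bound at `+T` for all `σ ∈ [1/4, 2]`
  have hplus : ∀ σ ∈ Icc (1 / 4 : ℝ) 2, ‖(riemannZeta (σ + T * I))⁻¹‖ ≤ T ^ ε := by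
    intro σ hσ
    rcases le_or_gt (1 / 2 + η) σ with hr | hr
    · -- right: Littlewood
      have := hT₁ σ T hr (by rw [hTabs]; linarith [hTI.1])
      rwa [hTabs] at this
    rcases le_or_gt (1 / 2 - η) σ with hm | hm
    · -- middle: the core
      exact hTcore σ ⟨hm, hr.le⟩
    · -- left: functional equation
      have hL := norm_inv_zeta_le_of_re_le_half (σ := σ) (T := T) (by linarith [hσ.1]) (by linarith)
        (by rw [hTabs]; linarith)
      have hLw : ‖(riemannZeta (((1 - σ : ℝ) : ℂ) + (-T) * I))⁻¹‖ ≤ T ^ (ε / 3) := by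
        have := hT₂ (1 - σ) (-T) (by linarith) (by rw [hTabs']; linarith [hTI.1])
        rw [hTabs'] at this
        convert this using 3
        push_cast; ring
      have h30 := hT₃ T (h3.trans hTI.1)
      calc ‖(riemannZeta (σ + T * I))⁻¹‖ ≤ 30 * π * ‖(riemannZeta (((1 - σ : ℝ) : ℂ) + (-T) * I))⁻¹‖ := hL
        _ ≤ T ^ (2 * ε / 3) * T ^ (ε / 3) := mul_le_mul h30 hLw (norm_nonneg _) (Real.rpow_nonneg hTpos.le _)
        _ = T ^ ε := by rw [← Real.rpow_add hTpos]; ring_nf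
  refine ⟨hplus σ hσ, ?_⟩
  -- at `-T` by conjugation
  have e : (σ : ℂ) - T * I = conj ((σ : ℂ) + T * I) := by
    simp [Complex.ext_iff]
  rw [e, riemannZeta_conj, ← map_inv₀, Complex.norm_conj]
  exact hplus σ hσ

end VeryGoodHeights

end Literature.NumberTheory.LFunctions

end
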